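import Mathlib
import Summits.Ventures.PercRepro2.CrossAPrimeIsolatedFlip
import Summits.Ventures.PercRepro2.CrossAPrimeMarkAtV

/-!
# A mark hanging off the other mark: `b` with the two edges `{b, o}` and the coin `{a₂, b}`
(blind cell PercRepro2, p5 g36; S4 §2.4 (s) addendum 42)

Let `b` have exactly two edges, `f = {b, o}` (weight `β`) and the coin `g = {a₂, b}` (weight `r`),
with `b ∉ {o, a₁, a₂, v}` — the kit model «`b` in a blob behind `u₁`» of j335194 with a one-vertex
blob, on ANY graph.  Along `f` the constant functional at `c = π = P(a₁ ↔ v)` is the quadratic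
`(1 − β)²Φ⁰⁰ + β(1 − β)(Φ⁰¹ + Φ¹⁰) + β²Φ¹¹` (`crossC_pin_quadratic`) and all three pieces are
nonnegative:
* under `p[f ↦ 0]` the mark `b` is independent (`b ∈ K` iff the coin is open, and the coin is
  invisible to `Q`, `o ∈ K`, `a₁ ↔ v`: `prob_bH_eq`, by the isolated-vertex flip), so
  `y = r·Z`, `yv = r·Zv`, `Dv = r·xv` and `Φ⁰⁰ = r·(Z·xv + x·(π·Z − Zv)) ≥ 0`
  (`π` is admissible for `p[f ↦ 0]`: `adm_pi_update_zero`);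
* under `p[f ↦ 1]` the marks coincide on the support (`b ↔ o` surely), so
  `Φ¹¹ = 2·xv·(Z − x) + π·x² ≥ 0`;
* the mixed term is `xv¹·((2 − r)Z⁰ − x⁰) + r·(2Z¹xv⁰ + x¹·(πZ⁰ − Zv⁰)) + x¹·(πx⁰ − xv⁰) ≥ 0`.
**`crossA'so_nonneg_of_pendant_mark`**.  Own work; standard axioms.
-/

namespace Summit.Ventures.PercRepro2

open LeafRowPendantRootSO CrossAPrimeA2Route CrossAPrimeSupport CrossAPrimeA2Induction
  CrossAPrimeA2VEdge CrossAPrimeIsolatedFlip CrossAPrimeMarkAtV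

namespace CrossAPrimePendantMark

variable {V : Type*} {E : Type*} [Fintype E] [DecidableEq E] [Fintype V] [DecidableEq V]
  {R : Type*} [Field R] [LinearOrder R] [IsStrictOrderedRing R]
variable {ends : E → Sym2 V}

omit [Fintype V] [DecidableEq V] [LinearOrder R] [IsStrictOrderedRing R] in
/-- An increasing event has a larger probability with an edge pinned open than pinned closed. -/
lemma prob_update_zero_le_update_one (p : E → R) [LinearOrder R] [IsStrictOrderedRing R]
    (hp : IsProbVec p) (e : E) {A : Set (Config E)} (hA : IsUpperSet A) :
    prob (Function.update p e 0) A ≤ prob (Function.update p e 1) A := by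
  rw [RBRootEdge.prob_update_one_eq, RBRootEdge.prob_update_zero_eq]
  refine prob_mono hp fun ω hω => ?_
  simp only [Set.mem_setOf_eq] at hω ⊢
  refine hA ?_ hω
  intro e'
  by_cases h : e' = e
  · subst h; simp
  · simp [Function.update_of_ne h]

omit [Fintype V] [DecidableEq V] in
/-- `π = P(a₁ ↔ v)` is admissible for `p[e ↦ 0]`. -/
lemma adm_pi_update_zero (p : E → R) (hp : IsProbVec p) (e : E) (a₁ a₂ v : V) :
    Adm (Function.update p e 0) (prob p (connEvent ends a₁ v)) ends a₁ a₂ v := by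
  intro W _ _
  have hq₀ : IsProbVec (Function.update p e 0) := hp.update e le_rfl zero_le_one
  have h1 : prob (Function.update p e 0) (delConn ends W a₁ v) ≤
      prob (Function.update p e 0) (connEvent ends a₁ v) :=
    prob_mono hq₀ fun ω hω => conn_mono (delConfig_le W ω) hω
  have h2 : prob (Function.update p e 0) (connEvent ends a₁ v) ≤ prob p (connEvent ends a₁ v) := by
    rw [prob_eq_pin p _ e]
    have h3 := prob_update_zero_le_update_one p hp e (isUpperSet_connEvent ends a₁ v)
    have hq0 := hp.nonneg e
    have hq1 := hp.le_one e
    nlinarith [mul_le_mul_of_nonneg_left h3 hq0]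
  exact h1.trans h2

omit [Fintype E] [DecidableEq E] [Fintype V] [DecidableEq V] [LinearOrder R]
  [IsStrictOrderedRing R] in
/-- On the support of `p[f ↦ 0]` (`f = {b, o}` null, `g = {a₂, b}` the only other edge at `b`),
`b ∈ K` is «`g` open». -/
lemma bH_iff_open_g {f g : E} {o a₂ b : V} (hf : ends f = s(b, o)) (hg : ends g = s(a₂, b))
    (hb : ∀ e, b ∈ ends e → e = f ∨ e = g) (hba₂ : b ≠ a₂) {ω : Config E} (hωf : ω f = false) :
    ω ∈ connEvent ends a₂ b ↔ ω ∈ openEdge g := by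
  constructor
  · intro hc
    by_contra hopen
    simp only [mem_openEdge, Bool.not_eq_true] at hopen
    have hiso : ∀ e, b ∈ ends e → ω e = false := by
      intro e he
      rcases hb e he with rfl | rfl
      · exact hωf
      · exact hopen
    exact hba₂ (eq_of_conn_of_isolated (ends := ends) hiso (conn_symm hc)).symm
  · intro hopen
    exact conn_of_openAdj ⟨g, hopen, hg⟩

omit [Fintype E] [Fintype V] [DecidableEq V] [LinearOrder R] [IsStrictOrderedRing R] in
/-- Flipping the coin `g = {a₂, b}` at an isolated `b` keeps `Q`, `o ∈ K` and `a₁ ↔ v`. -/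
lemma flip3_iff_of_isolated {g : E} {o a₁ a₂ v b : V} (hg : ends g = s(a₂, b)) {ω : Config E}
    (hiso : ∀ e', b ∈ ends e' → ω e' = false) (hba₁ : a₁ ≠ b) (hba₂ : a₂ ≠ b) (hbo : o ≠ b)
    (hbv : v ≠ b) :
    (Function.update ω g true ∈ avoidAll ends a₂ {a₁} ↔ ω ∈ avoidAll ends a₂ {a₁}) ∧
      (Function.update ω g true ∈ connEvent ends a₂ o ↔ ω ∈ connEvent ends a₂ o) ∧
      (Function.update ω g true ∈ connEvent ends a₁ v ↔ ω ∈ connEvent ends a₁ v) := by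
  refine ⟨?_, ?_, ?_⟩
  · simp only [avoidAll, Set.mem_setOf_eq, Finset.mem_singleton, forall_eq]
    rw [conn_update_true_iff_of_isolated hg hiso hba₂ hba₁]
  · exact conn_update_true_iff_of_isolated hg hiso hba₂ hbo
  · exact conn_update_true_iff_of_isolated hg hiso hba₁ hbv

omit [Fintype V] [DecidableEq V] [LinearOrder R] [IsStrictOrderedRing R] in
/-- **The independent mark**: under `p[f ↦ 0]`, `P(Q ∩ A ∩ {b ∈ K}) = r·P(Q ∩ A)` for the events
`A` built from `a₁ ↔ v` and `o ∈ K` (`r = p g`). -/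
lemma prob_bH_eq (p : E → R) {f g : E} {o a₁ a₂ v b : V} (hf : ends f = s(b, o))
    (hg : ends g = s(a₂, b)) (hb : ∀ e, b ∈ ends e → e = f ∨ e = g) (hfg : f ≠ g)
    (hba₁ : a₁ ≠ b) (hba₂ : a₂ ≠ b) (hbo : o ≠ b) (hbv : v ≠ b) (A : Set (Config E))
    (hA : ∀ ω : Config E, (∀ e, b ∈ ends e → ω e = false) →
      (Function.update ω g true ∈ A ↔ ω ∈ A)) :
    prob (Function.update p f 0) (avoidAll ends a₂ {a₁} ∩ (A ∩ connEvent ends a₂ b)) =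
      p g * prob (Function.update p f 0) (avoidAll ends a₂ {a₁} ∩ A) := by
  -- step 1: on the support, `b ∈ K` is `g` open
  have e1 : avoidAll ends a₂ {a₁} ∩ (A ∩ connEvent ends a₂ b) ∩ supp (Function.update p f 0) =
      avoidAll ends a₂ {a₁} ∩ A ∩ openEdge g ∩ supp (Function.update p f 0) := by
    ext ω
    simp only [Set.mem_inter_iff]
    have hωf : ω ∈ supp (Function.update p f 0) → ω f = false := fun hs => (hs f).2 (by simp)
    constructor
    · rintro ⟨⟨hQ, hA', hbK⟩, hs⟩
      exact ⟨⟨⟨hQ, hA'⟩, (bH_iff_open_g hf hg hb hba₂.symm (hωf hs)).1 hbK⟩, hs⟩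
    · rintro ⟨⟨⟨hQ, hA'⟩, hopen⟩, hs⟩
      exact ⟨⟨hQ, hA', (bH_iff_open_g hf hg hb hba₂.symm (hωf hs)).2 hopen⟩, hs⟩
  rw [prob_congr_supp _ e1, prob_inter_openEdge, Function.update_of_ne hfg.symm]
  -- step 2: flipping the coin at the isolated `b` is invisible
  have hflip : prob (Function.update (Function.update p f 0) g 1) (avoidAll ends a₂ {a₁} ∩ A) =
      prob (Function.update (Function.update p f 0) g 0) (avoidAll ends a₂ {a₁} ∩ A) := by
    refine prob_update_one_eq_update_zero_of_isolated (ends := ends) _ (z := b) ?_ ?_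
    · intro e' he' hne
      rcases hb e' he' with rfl | rfl
      · simp
      · exact absurd rfl hne
    · intro ω hiso
      obtain ⟨hQ, -, -⟩ := flip3_iff_of_isolated (o := o) (v := v) hg hiso hba₁ hba₂ hbo hbv
      simp only [Set.mem_inter_iff, hQ, hA ω hiso]
  -- step 3: the pinning identity
  have hpin := prob_eq_pin (Function.update p f 0) (avoidAll ends a₂ {a₁} ∩ A) g
  rw [Function.update_of_ne hfg.symm, hflip] at hpin
  have heq : prob (Function.update p f 0) (avoidAll ends a₂ {a₁} ∩ A) =
      prob (Function.update (Function.update p f 0) g 0) (avoidAll ends a₂ {a₁} ∩ A) := by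
    linear_combination hpin
  rw [hflip, heq]

omit [Fintype E] [DecidableEq E] [Fintype V] [DecidableEq V] in
/-- The algebra of the pendant mark: the three pieces of the quadratic along `f`. -/
lemma pendant_algebra {β r π Z0 x0 xv0 Zv0 Z1 x1 xv1 : R} (hβ0 : 0 ≤ β) (hβ1 : β ≤ 1)
    (hr0 : 0 ≤ r) (hr1 : r ≤ 1) (hπ0 : 0 ≤ π) (hZ0 : 0 ≤ Z0) (hx0 : 0 ≤ x0) (hxv0 : 0 ≤ xv0)
    (hZ1 : 0 ≤ Z1) (hx1 : 0 ≤ x1) (hxv1 : 0 ≤ xv1) (hZx0 : x0 ≤ Z0) (hZx1 : x1 ≤ Z1)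
    (hxvπ : xv0 ≤ π * x0) (hZvπ : Zv0 ≤ π * Z0) :
    0 ≤ (1 - β) ^ 2 * (2 * Z0 * (r * xv0) - r * Z0 * xv0 + π * x0 * (r * Z0) - x0 * (r * Zv0)) +
        β * (1 - β) *
          ((2 * Z0 * xv1 - r * Z0 * xv1 + π * x0 * x1 - x0 * xv1) +
            (2 * Z1 * (r * xv0) - x1 * xv0 + π * x1 * (r * Z0) - x1 * (r * Zv0))) +
        β ^ 2 * (2 * Z1 * xv1 - x1 * xv1 + π * x1 * x1 - x1 * xv1) := by
  have eA : 2 * Z0 * (r * xv0) - r * Z0 * xv0 + π * x0 * (r * Z0) - x0 * (r * Zv0) =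
      r * (Z0 * xv0 + x0 * (π * Z0 - Zv0)) := by ring
  have eB : 2 * Z1 * xv1 - x1 * xv1 + π * x1 * x1 - x1 * xv1 =
      2 * xv1 * (Z1 - x1) + π * (x1 * x1) := by ring
  have eM : (2 * Z0 * xv1 - r * Z0 * xv1 + π * x0 * x1 - x0 * xv1) +
      (2 * Z1 * (r * xv0) - x1 * xv0 + π * x1 * (r * Z0) - x1 * (r * Zv0)) =
      xv1 * ((2 - r) * Z0 - x0) + r * (2 * Z1 * xv0) + r * (x1 * (π * Z0 - Zv0)) +
        x1 * (π * x0 - xv0) := by ring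
  rw [eA, eB, eM]
  have tA : 0 ≤ r * (Z0 * xv0 + x0 * (π * Z0 - Zv0)) :=
    mul_nonneg hr0 (add_nonneg (mul_nonneg hZ0 hxv0) (mul_nonneg hx0 (by linarith)))
  have tB : 0 ≤ 2 * xv1 * (Z1 - x1) + π * (x1 * x1) :=
    add_nonneg (mul_nonneg (mul_nonneg (by norm_num) hxv1) (by linarith))
      (mul_nonneg hπ0 (mul_nonneg hx1 hx1))
  have tM : 0 ≤ xv1 * ((2 - r) * Z0 - x0) + r * (2 * Z1 * xv0) + r * (x1 * (π * Z0 - Zv0)) +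
      x1 * (π * x0 - xv0) := by
    have m1 : 0 ≤ xv1 * ((2 - r) * Z0 - x0) := by
      refine mul_nonneg hxv1 ?_
      have := mul_nonneg (sub_nonneg.2 hr1) hZ0
      linarith
    have m2 : 0 ≤ r * (2 * Z1 * xv0) := mul_nonneg hr0 (mul_nonneg (mul_nonneg (by norm_num) hZ1) hxv0)
    have m3 : 0 ≤ r * (x1 * (π * Z0 - Zv0)) := mul_nonneg hr0 (mul_nonneg hx1 (by linarith))
    have m4 : 0 ≤ x1 * (π * x0 - xv0) := mul_nonneg hx1 (by linarith)
    linarith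
  have c1 : 0 ≤ (1 - β) ^ 2 * (r * (Z0 * xv0 + x0 * (π * Z0 - Zv0))) := mul_nonneg (sq_nonneg _) tA
  have c2 : 0 ≤ β * (1 - β) * (xv1 * ((2 - r) * Z0 - x0) + r * (2 * Z1 * xv0) +
      r * (x1 * (π * Z0 - Zv0)) + x1 * (π * x0 - xv0)) :=
    mul_nonneg (mul_nonneg hβ0 (sub_nonneg.2 hβ1)) tM
  have c3 : 0 ≤ β ^ 2 * (2 * xv1 * (Z1 - x1) + π * (x1 * x1)) := mul_nonneg (sq_nonneg _) tB
  linarith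

omit [DecidableEq V] in
/-- **A mark hanging off the other mark**: `b` has exactly the edges `f = {b, o}` and the coin
`g = {a₂, b}`; then `0 ≤ crossA′so` for every graph otherwise. -/
theorem crossA'so_nonneg_of_pendant_mark (p : E → R) (hp : IsProbVec p) {f g : E}
    {o a₁ a₂ v b : V} (hf : ends f = s(b, o)) (hg : ends g = s(a₂, b))
    (hb : ∀ e, b ∈ ends e → e = f ∨ e = g) (hfg : f ≠ g)
    (hba₁ : a₁ ≠ b) (hba₂ : a₂ ≠ b) (hbo : o ≠ b) (hbv : v ≠ b) :
    0 ≤ crossA'so p ends o a₁ a₂ v b := by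
  classical
  rw [crossA'so_eq_crossC, crossC_pin_quadratic p _ ends f o a₁ a₂ v b, ← crossC_eq_crossPatC]
  set π := prob p (connEvent ends a₁ v) with hπ
  set Q := avoidAll ends a₂ {a₁} with hQ
  set oH := connEvent ends a₂ o
  set bH := connEvent ends a₂ b
  set L := connEvent ends a₁ v
  have hq₀ : IsProbVec (Function.update p f 0) := hp.update f le_rfl zero_le_one
  have hq₁ : IsProbVec (Function.update p f 1) := hp.update f zero_le_one le_rfl
  have hr0 : 0 ≤ p g := hp.nonneg g
  have hβ0 : 0 ≤ p f := hp.nonneg f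
  have hβ1 : p f ≤ 1 := hp.le_one f
  -- the independent mark under `p[f ↦ 0]`
  have flipQ : ∀ ω : Config E, (∀ e, b ∈ ends e → ω e = false) →
      ((Function.update ω g true ∈ Q ↔ ω ∈ Q) ∧
        (Function.update ω g true ∈ oH ↔ ω ∈ oH) ∧
        (Function.update ω g true ∈ L ↔ ω ∈ L)) := by
    intro ω hiso
    exact flip3_iff_of_isolated (o := o) (v := v) hg hiso hba₁ hba₂ hbo hbv
  have hy0 : prob (Function.update p f 0) (Q ∩ bH) = p g * prob (Function.update p f 0) Q := by
    have := prob_bH_eq (ends := ends) p hf hg hb hfg hba₁ hba₂ hbo hbv Set.univ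
      (fun ω _ => by simp)
    simpa only [Set.univ_inter, Set.inter_univ] using this
  have hyv0 : prob (Function.update p f 0) (Q ∩ (L ∩ bH)) =
      p g * prob (Function.update p f 0) (Q ∩ L) :=
    prob_bH_eq (ends := ends) p hf hg hb hfg hba₁ hba₂ hbo hbv L (fun ω hiso => (flipQ ω hiso).2.2)
  have hDv0 : prob (Function.update p f 0) (Q ∩ (L ∩ (oH ∩ bH))) =
      p g * prob (Function.update p f 0) (Q ∩ (L ∩ oH)) := by
    have := prob_bH_eq (ends := ends) p hf hg hb hfg hba₁ hba₂ hbo hbv (L ∩ oH)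
      (fun ω hiso => by
        simp only [Set.mem_inter_iff, (flipQ ω hiso).2.1, (flipQ ω hiso).2.2])
    rwa [Set.inter_assoc L oH bH] at this
  -- the coincident marks under `p[f ↦ 1]`
  have hsame : ∀ A : Set (Config E),
      prob (Function.update p f 1) (Q ∩ (A ∩ bH)) = prob (Function.update p f 1) (Q ∩ (A ∩ oH)) := by
    intro A
    apply prob_congr_supp
    ext ω
    simp only [Set.mem_inter_iff]
    have hco : ω ∈ supp (Function.update p f 1) → Conn ends ω b o := fun hs =>
      conn_of_openAdj ⟨f, (hs f).1 (by simp), hf⟩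
    constructor
    · rintro ⟨⟨hQ, hA, hbK⟩, hs⟩
      exact ⟨⟨hQ, hA, conn_trans hbK (hco hs)⟩, hs⟩
    · rintro ⟨⟨hQ, hA, hoK⟩, hs⟩
      exact ⟨⟨hQ, hA, conn_trans hoK (conn_symm (hco hs))⟩, hs⟩
  have hy1 : prob (Function.update p f 1) (Q ∩ bH) = prob (Function.update p f 1) (Q ∩ oH) := by
    have := hsame Set.univ
    simpa only [Set.univ_inter] using this
  have hyv1 : prob (Function.update p f 1) (Q ∩ (L ∩ bH)) =
      prob (Function.update p f 1) (Q ∩ (L ∩ oH)) := hsame L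
  have hDv1 : prob (Function.update p f 1) (Q ∩ (L ∩ (oH ∩ bH))) =
      prob (Function.update p f 1) (Q ∩ (L ∩ oH)) := by
    have := hsame (L ∩ oH)
    rw [Set.inter_assoc L oH bH] at this
    rw [this, Set.inter_assoc, Set.inter_self]
  -- admissibility under `p[f ↦ 0]`
  have hadm := adm_pi_update_zero (ends := ends) p hp f a₁ a₂ v
  have hxvπ : prob (Function.update p f 0) (Q ∩ (L ∩ oH)) ≤
      π * prob (Function.update p f 0) (Q ∩ oH) := by
    have := prob_Q_L_le (ends := ends) _ hq₀ hadm o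
    exact this
  have hZvπ : prob (Function.update p f 0) (Q ∩ L) ≤ π * prob (Function.update p f 0) Q := by
    have key := prob_Q_vL_le_mul hq₀ hadm (Set.univ : Set (Set V))
    have cu : clusterInEvent ends a₂ (Set.univ : Set (Set V)) = Set.univ := by
      ext ω; simp [clusterInEvent]
    rw [cu, Set.univ_inter, Set.univ_inter, Set.inter_comm] at key
    exact key
  -- names and signs
  have hZ0 : 0 ≤ prob (Function.update p f 0) Q := prob_nonneg hq₀ _
  have hx0 : 0 ≤ prob (Function.update p f 0) (Q ∩ oH) := prob_nonneg hq₀ _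
  have hxv0 : 0 ≤ prob (Function.update p f 0) (Q ∩ (L ∩ oH)) := prob_nonneg hq₀ _
  have hZ1 : 0 ≤ prob (Function.update p f 1) Q := prob_nonneg hq₁ _
  have hx1 : 0 ≤ prob (Function.update p f 1) (Q ∩ oH) := prob_nonneg hq₁ _
  have hxv1 : 0 ≤ prob (Function.update p f 1) (Q ∩ (L ∩ oH)) := prob_nonneg hq₁ _
  have hZx0 : prob (Function.update p f 0) (Q ∩ oH) ≤ prob (Function.update p f 0) Q :=
    prob_mono hq₀ Set.inter_subset_left
  have hZx1 : prob (Function.update p f 1) (Q ∩ oH) ≤ prob (Function.update p f 1) Q :=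
    prob_mono hq₁ Set.inter_subset_left
  have hr1 : p g ≤ 1 := hp.le_one g
  have hπ0 : 0 ≤ π := prob_nonneg hp _
  -- the three pieces
  unfold crossC crossPatC
  rw [hy0, hyv0, hDv0, hy1, hyv1, hDv1]
  exact pendant_algebra hβ0 hβ1 hr0 hr1 hπ0 hZ0 hx0 hxv0 hZ1 hx1 hxv1 hZx0 hZx1 hxvπ hZvπ

end CrossAPrimePendantMark

end Summit.Ventures.PercRepro2
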